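import Mathlib

/-!
# Route `FilamentSkeletonRss` · child crux `TangentSkeletonNearStraightL` (stmt-NavierStokesRegularity-23320) · registered line
# `child_tangent_analytic_strip_L` (b0b56c52900dd90a), stub `stub_stripPropagation` — brick: THE SHIFTED-CONTOUR FORMULA (RECTANGLE)

R7 of the STUB-PLAN memo attached to 23320 defines the continued field locally through a z-INDEPENDENT deformed source contour and needs the
rectangle Cauchy theorem in the source variable to move between contours.  This file packages Mathlib's
`Complex.integral_boundary_rect_eq_zero_of_differentiableOn` in the form used there: for `h` holomorphic on an open set containing the closed
rectangle `[[x₁, x₂]] × [[y₀, y₁]]`,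
`∫_{x₁}^{x₂} h(t + i y₀) dt = ∫_{x₁}^{x₂} h(t + i y₁) dt − i·∫_{y₀}^{y₁} h(x₂ + i s) ds + i·∫_{y₀}^{y₁} h(x₁ + i s) ds`
(`integral_horizontal_eq_shifted`; counter-clockwise boundary = 0), and its real-axis case `y₀ = 0` (`integral_real_eq_shifted`): the integral over a
real parameter window equals the integral over the window shifted to height `y₁` plus the two vertical connectors — the near-diagonal contour of
the strip propagation.
HONEST FRAMING: a complex-analysis brick for a plan about a HYPOTHETICAL filament skeleton on the NEGATIVE side of a MODEL route; the stub
`stub_stripPropagation` is NOT closed; nothing here bears on Navier–Stokes regularity or blow-up.  `--supports stmt-NavierStokesRegularity-23320`.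
-/

set_option linter.dupNamespace false

noncomputable section

namespace Summit.NavierStokesRegularity.NavierStokesRegularity.Theorems.StadiumShiftedContour

open Set MeasureTheory Complex

variable {G : Type*} [NormedAddCommGroup G] [NormedSpace ℂ G]

/-- **Shifted-contour formula.**  `h` holomorphic on `U ⊇ uIcc x₁ x₂ ×ℂ uIcc y₀ y₁`:
`∫_{x₁}^{x₂} h(t + y₀ i) dt = ∫_{x₁}^{x₂} h(t + y₁ i) dt − i•∫_{y₀}^{y₁} h(x₂ + s i) ds + i•∫_{y₀}^{y₁} h(x₁ + s i) ds`. [folklore] -/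
theorem integral_horizontal_eq_shifted {U : Set ℂ} {h : ℂ → G} (hh : DifferentiableOn ℂ h U) {x₁ x₂ y₀ y₁ : ℝ}
    (hsub : (Set.uIcc x₁ x₂ ×ℂ Set.uIcc y₀ y₁) ⊆ U) :
    ∫ t in x₁..x₂, h ((t : ℂ) + (y₀ : ℂ) * I) =
      (∫ t in x₁..x₂, h ((t : ℂ) + (y₁ : ℂ) * I)) - I • (∫ s in y₀..y₁, h ((x₂ : ℂ) + (s : ℂ) * I))
        + I • (∫ s in y₀..y₁, h ((x₁ : ℂ) + (s : ℂ) * I)) := by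
  have e1 : ((x₁ : ℂ) + (y₀ : ℂ) * I).re = x₁ := by simp
  have e2 : ((x₂ : ℂ) + (y₁ : ℂ) * I).re = x₂ := by simp
  have e3 : ((x₁ : ℂ) + (y₀ : ℂ) * I).im = y₀ := by simp
  have e4 : ((x₂ : ℂ) + (y₁ : ℂ) * I).im = y₁ := by simp
  have H : DifferentiableOn ℂ h (Set.uIcc ((x₁ : ℂ) + (y₀ : ℂ) * I).re ((x₂ : ℂ) + (y₁ : ℂ) * I).re ×ℂ
      Set.uIcc ((x₁ : ℂ) + (y₀ : ℂ) * I).im ((x₂ : ℂ) + (y₁ : ℂ) * I).im) := by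
    rw [e1, e2, e3, e4]; exact hh.mono hsub
  have hrect := Complex.integral_boundary_rect_eq_zero_of_differentiableOn h ((x₁ : ℂ) + (y₀ : ℂ) * I) ((x₂ : ℂ) + (y₁ : ℂ) * I) H
  rw [e1, e2, e3, e4] at hrect
  -- `hrect : (A − B) + I•C₂ − I•C₁ = 0`
  set A := ∫ t in x₁..x₂, h ((t : ℂ) + (y₀ : ℂ) * I)
  set B := ∫ t in x₁..x₂, h ((t : ℂ) + (y₁ : ℂ) * I)
  set C₂ := ∫ s in y₀..y₁, h ((x₂ : ℂ) + (s : ℂ) * I)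
  set C₁ := ∫ s in y₀..y₁, h ((x₁ : ℂ) + (s : ℂ) * I)
  have h1 : A = A - B + I • C₂ - I • C₁ + (B - I • C₂ + I • C₁) := by abel
  rw [hrect, zero_add] at h1
  exact h1

/-- **Real-axis case.**  `h` holomorphic on `U ⊇ uIcc x₁ x₂ ×ℂ uIcc 0 y`:
`∫_{x₁}^{x₂} h(t) dt = ∫_{x₁}^{x₂} h(t + y i) dt − i•∫_0^y h(x₂ + s i) ds + i•∫_0^y h(x₁ + s i) ds`. [folklore] -/
theorem integral_real_eq_shifted {U : Set ℂ} {h : ℂ → G} (hh : DifferentiableOn ℂ h U) {x₁ x₂ y : ℝ}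
    (hsub : (Set.uIcc x₁ x₂ ×ℂ Set.uIcc 0 y) ⊆ U) :
    ∫ t in x₁..x₂, h (t : ℂ) =
      (∫ t in x₁..x₂, h ((t : ℂ) + (y : ℂ) * I)) - I • (∫ s in (0:ℝ)..y, h ((x₂ : ℂ) + (s : ℂ) * I))
        + I • (∫ s in (0:ℝ)..y, h ((x₁ : ℂ) + (s : ℂ) * I)) := by
  have h0 := integral_horizontal_eq_shifted hh (y₀ := 0) (y₁ := y) hsub
  simpa using h0

end Summit.NavierStokesRegularity.NavierStokesRegularity.Theorems.StadiumShiftedContour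

end
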